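import Mathlib.MeasureTheory.Measure.Lebesgue.VolumeOfBalls
import Mathlib.Analysis.Complex.ExponentialBounds
import Summits.QuantumFields.YangMills.Theorems.BalabanUVNodesN19TchakaloffCubature
import Summits.QuantumFields.YangMills.Theorems.BalabanUVNodesN19JointLawPriceDimensionWitness

/-!
# YM-DAG node N19 (= NE7 proper) — THE DIMENSION DEPENDENCE OF THE JOINT-LAW PRICE IS `|ι|²`: Tchakaloff atoms of the uniform law vs the
# volume of ℓ¹-balls (`d²∕(128(t + d))` at mixed-moment closeness `(1∕2)^t`; two-sided with module 65's `(76K + 12G∕d)·d²∕(1 + log r⁻¹)`)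

Cell `pub-ymgap`, HUMAN RULING D-0062 (Track A) ∕ D-0149 (work-bound push), R141 (C) wider-strategy seat `pub-ymgap-dag-n19-e` (strategy
s3 = ALTERNATIVE CURRENCY), generation g27, module 2 (lineage module 107).  Route `Summits/QuantumFields/YangMills/Theses/BalabanUVNodes.lean`,
cluster item K3⁸ «SpineGivenEndpointR13SepCoPHV» (stmt-QuantumFields-27366); filed `--supports` that item `--as helper` (it proves no registered
stub).  COUNT-NEUTRAL: [folklore] convex geometry ∕ metric entropy over Mathlib (`volume_sum_rpow_lt`, `Real.pow_div_factorial_le_exp`,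
`mul_meas_ge_le_integral_of_nonneg`) and the lineage BY NAME — module 106 `…N19TchakaloffCubature` (`exists_cubature_measure`), module 65
`…N19JointLawPriceDimension` (`law_price_le_of_uniformMixedMoments`, quoted in the two-sided statement); no scheme object, no Theses import;
NOT a discharge claim.

THE QUESTION (open item (v) of the lineage's CURRENCY-MAP since g21).  Under UNIFORM MIXED-MOMENT closeness `r` of two laws on `[−1,1]^ι`
(`d = |ι|`), module 65 prices every ℓ¹-`K`-Lipschitz, `G`-bounded functional at `(76K d² + 12G d)∕(1 + log r⁻¹)`; module 66's product binomial
witness pays an ADDITIVE functional `≍ d∕log r⁻¹`, so the additive class is `Θ(d∕log r⁻¹)` two-sided, and every PRODUCT witness reduces to one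
dimension.  Is the general class `d` or `d²`?

THE ANSWER ★★★ `exists_uniformMixedMoments_close_laws_far_sq`: **`d²`**.  For every `t : ℕ` there are probability laws `P, Q` on `[−½,½]^ι`
with ALL mixed moments `(1∕2)^t`-close (EQUAL in total degree `≤ t`) and a continuous test `g ≥ 0`, `|g(u) − g(v)| ≤ Σ_i|u_i − v_i|` everywhere,
`g ≤ 2d` on `[−1,1]^ι`, with `∫g dQ − ∫g dP ≥ d²∕(128(t + d))`.  In module 66's shape ★★ `jointLaw_price_general_two_sided`: module 65's upper
bound verbatim, and for every `0 < r₀ ≤ 1` a witness at some `r ≤ r₀` paying `≥ d²∕(256(d + log r⁻¹))` — against `(76 + 24)d²∕(1 + log r⁻¹)` at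
`K = 1`, `G = 2d`: `Θ(d²∕log r⁻¹)` TWO-SIDED as soon as `log r⁻¹ ≥ d`, a genuine factor `|ι|` above the additive class.
MECHANISM — VOLUME vs DIMENSION.  `Q` = the uniform law on the half-cube; `P` = a Tchakaloff cubature of `Q` of strength `t` (module 106:
`N ≤ (e(t+d)∕d)^d + 1` atoms `z_k` in the half-cube, positive weights, equal moments of total degree `≤ t`); higher mixed moments are `≤ (1∕2)^{t+1}`
in absolute value on the half-cube (§1).  The test `g(x) = min_k Σ_i|x_i − z_{k,i}|` vanishes on the atoms (`∫g dP = 0`), and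
`Q(g < ρ) ≤ N·vol{Σ|x_i| < ρ} = N(2ρ)^d∕d! ≤ N(2eρ∕d)^d` (§2: Mathlib's `volume_sum_rpow_lt` at `p = 1`, translation invariance, `d^d ≤ e^d d!`);
at `ρ = d²∕(8e²(t+d))` this is `≤ 2·4^{−d} ≤ ½`, so `∫g dQ ≥ ρ∕2 ≥ d²∕(128(t+d))` (§3, `e² ≤ 8`).  (A PRODUCT cubature — Gauss^{⊗d},
`((t+1)∕2)^d` atoms — gives only `d∕t`: total degree versus coordinate degree is exactly the `|ι|` versus `|ι|²` accounting of modules 65∕66.)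
READING for N19 (honest): under the UNIFORM target, `d` strings converge JOINTLY on ℓ¹-Lipschitz functionals no faster than `≍ d²∕log R_K⁻¹` in
the worst case (module 67's closed form is sharp in order), while sums of one-string observables converge at `≍ d∕log R_K⁻¹`.

HONEST FRAMING (binding).  Elementary and [folklore]; TOY laws (uniform law + finitely many atoms), NO scheme object; NO consumer in the DAG
today (an optimality statement about the seat's own currency); nothing of Bałaban's instantiated; NE7 NOT PRINTED, NOT proved; N19 NOT discharged;
count-neutral.  One finite `T⁴` programme at fixed `ε`; nothing continuum ∕ `ℝ⁴` ∕ OS ∕ mass-gap ∕ Clay.  0 `def` ∕ 0 `sorry`.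
-/

noncomputable section

open Real Finset MeasureTheory

namespace Summit.QuantumFields.YangMills.Theorems.BalabanUVNodesN19JointLawPriceDimensionSharp

open Summit.QuantumFields.YangMills.Theorems.BalabanUVNodesN19TchakaloffCubature (exists_cubature_measure)
open Summit.QuantumFields.YangMills.Theorems.BalabanUVNodesN19JointLawPriceDimension (law_price_le_of_uniformMixedMoments)

variable {ι : Type*} [Fintype ι]

/-! ## §1 Laws on the half-cube: high mixed moments are small for free [bookkeeping] -/

omit [Fintype ι] in
/-- A probability law carried by `S` integrates a function bounded by `G` on `S` within `G`. [bookkeeping] -/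
theorem abs_integral_le_of_carried {P : Measure (ι → ℝ)} [IsProbabilityMeasure P] {S : Set (ι → ℝ)} (hP : P Sᶜ = 0)
    {f : (ι → ℝ) → ℝ} {G : ℝ} (hG : ∀ u ∈ S, |f u| ≤ G) : |∫ x, f x ∂P| ≤ G := by
  have hae : ∀ᵐ x ∂P, x ∈ S := mem_ae_iff.2 hP
  have hbound : ∀ᵐ x ∂P, ‖f x‖ ≤ G := hae.mono fun x hx => by rw [Real.norm_eq_abs]; exact hG x hx
  have h := norm_integral_le_of_norm_le_const hbound
  rwa [probReal_univ, mul_one, Real.norm_eq_abs] at h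

/-- On the half-cube `[−½,½]^ι` a mixed monomial is at most `(1∕2)^{Σ j_i}` in absolute value. [bookkeeping] -/
theorem abs_prod_pow_le_half_pow {u : ι → ℝ} (hu : ∀ i, u i ∈ Set.Icc (-(1 / 2 : ℝ)) (1 / 2)) (j : ι → ℕ) :
    |∏ i, u i ^ j i| ≤ (1 / 2 : ℝ) ^ ∑ i, j i := by
  rw [Finset.abs_prod, ← Finset.prod_pow_eq_pow_sum]
  refine Finset.prod_le_prod (fun i _ => abs_nonneg _) fun i _ => ?_
  rw [abs_pow]
  exact pow_le_pow_left₀ (abs_nonneg _) (abs_le.2 ⟨by linarith [(hu i).1], (hu i).2⟩) _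

/-- ★ Two probability laws on the half-cube with EQUAL mixed moments of total degree `≤ t` have ALL mixed moments `(1∕2)^t`-close. [folklore] -/
theorem abs_moment_sub_moment_le_half_pow {P Q : Measure (ι → ℝ)} [IsProbabilityMeasure P] [IsProbabilityMeasure Q]
    (hP : P (Set.pi Set.univ (fun _ : ι => Set.Icc (-(1 / 2 : ℝ)) (1 / 2)))ᶜ = 0)
    (hQ : Q (Set.pi Set.univ (fun _ : ι => Set.Icc (-(1 / 2 : ℝ)) (1 / 2)))ᶜ = 0) {t : ℕ}
    (heq : ∀ j : ι → ℕ, ∑ i, j i ≤ t → ∫ x, ∏ i, x i ^ j i ∂P = ∫ x, ∏ i, x i ^ j i ∂Q) (j : ι → ℕ) :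
    |∫ x, ∏ i, x i ^ j i ∂P - ∫ x, ∏ i, x i ^ j i ∂Q| ≤ (1 / 2 : ℝ) ^ t := by
  rcases le_or_gt (∑ i, j i) t with hj | hj
  · rw [heq j hj, sub_self, abs_zero]; positivity
  · have hb : ∀ u ∈ Set.pi Set.univ (fun _ : ι => Set.Icc (-(1 / 2 : ℝ)) (1 / 2)),
        |∏ i, u i ^ j i| ≤ (1 / 2 : ℝ) ^ (t + 1) := fun u hu =>
      (abs_prod_pow_le_half_pow (fun i => Set.mem_univ_pi.1 hu i) j).trans
        (pow_le_pow_of_le_one (by norm_num) (by norm_num) hj)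
    calc |∫ x, ∏ i, x i ^ j i ∂P - ∫ x, ∏ i, x i ^ j i ∂Q|
        ≤ |∫ x, ∏ i, x i ^ j i ∂P| + |∫ x, ∏ i, x i ^ j i ∂Q| := abs_sub _ _
      _ ≤ (1 / 2 : ℝ) ^ (t + 1) + (1 / 2 : ℝ) ^ (t + 1) :=
          add_le_add (abs_integral_le_of_carried hP hb) (abs_integral_le_of_carried hQ hb)
      _ = (1 / 2 : ℝ) ^ t := by rw [pow_succ]; ring

/-! ## §2 The volume of ℓ¹-balls: `vol{Σ_i|x_i − z_i| < ρ} = (2ρ)^d∕d! ≤ (2eρ∕d)^d` [folklore] -/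

/-- The volume of the ℓ¹-ball: `vol{x : Σ_i|x_i| < ρ} = ρ^d · 2^d∕d!` (Mathlib's `volume_sum_rpow_lt` at `p = 1`). [folklore] -/
theorem volume_l1Ball [Nonempty ι] (ρ : ℝ) :
    volume {x : ι → ℝ | ∑ i, |x i| < ρ} =
      ENNReal.ofReal ρ ^ Fintype.card ι * ENNReal.ofReal (2 ^ Fintype.card ι / (Fintype.card ι).factorial) := by
  have h := MeasureTheory.volume_sum_rpow_lt ι (le_refl (1 : ℝ)) ρ
  have hset : {x : ι → ℝ | (∑ i, |x i| ^ (1 : ℝ)) ^ (1 / (1 : ℝ)) < ρ} = {x : ι → ℝ | ∑ i, |x i| < ρ} := by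
    ext x
    simp only [Set.mem_setOf_eq, Real.rpow_one, div_one]
  rw [hset] at h
  rw [h]
  congr 2
  rw [div_one, div_one, show (1 : ℝ) + 1 = 2 by norm_num, Real.Gamma_two, mul_one, Real.Gamma_nat_eq_factorial]

/-- Translation invariance: the ℓ¹-ball about `z` has the volume of the ℓ¹-ball about `0`. [bookkeeping] -/
theorem volume_l1Ball_sub (z : ι → ℝ) (ρ : ℝ) :
    volume {x : ι → ℝ | ∑ i, |x i - z i| < ρ} = volume {x : ι → ℝ | ∑ i, |x i| < ρ} := by
  have hset : {x : ι → ℝ | ∑ i, |x i - z i| < ρ} = (fun x => -z + x) ⁻¹' {x : ι → ℝ | ∑ i, |x i| < ρ} := by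
    ext x
    simp only [Set.mem_setOf_eq, Set.mem_preimage, neg_add_eq_sub, Pi.sub_apply]
  rw [hset, measure_preimage_add]

/-- ★ `vol{Σ_i|x_i − z_i| < ρ} ≤ (2eρ∕d)^d` (`ρ ≥ 0`, `d = |ι| ≥ 1`). [folklore] -/
theorem volume_l1Ball_sub_le [Nonempty ι] (z : ι → ℝ) {ρ : ℝ} (hρ : 0 ≤ ρ) :
    volume {x : ι → ℝ | ∑ i, |x i - z i| < ρ} ≤
      ENNReal.ofReal ((2 * Real.exp 1 * ρ / Fintype.card ι) ^ Fintype.card ι) := by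
  set d : ℕ := Fintype.card ι with hd
  have hd1 : 1 ≤ d := Fintype.card_pos
  have hdpos : (0 : ℝ) < d := by exact_mod_cast hd1
  rw [volume_l1Ball_sub, volume_l1Ball, ← hd, ← ENNReal.ofReal_pow hρ, ← ENNReal.ofReal_mul (pow_nonneg hρ d)]
  refine ENNReal.ofReal_le_ofReal ?_
  have hfac : (0 : ℝ) < d.factorial := by exact_mod_cast Nat.factorial_pos d
  have hkey : (2 : ℝ) ^ d / d.factorial ≤ (2 * Real.exp 1 / d) ^ d := by
    rw [div_le_iff₀ hfac, div_pow, mul_pow, div_mul_eq_mul_div, le_div_iff₀ (pow_pos hdpos d)]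
    -- `d^d ≤ e^d · d!` from `x^n∕n! ≤ e^x` at `x = n = d` (the tree's `…Graham2010.pow_self_le_exp_mul_factorial`, inlined)
    have h : (d : ℝ) ^ d ≤ Real.exp 1 ^ d * (d.factorial : ℝ) := by
      have h0 := Real.pow_div_factorial_le_exp (d : ℝ) (Nat.cast_nonneg d) d
      rw [div_le_iff₀ hfac] at h0
      rwa [← Real.exp_nat_mul, mul_one]
    have h2 : (0 : ℝ) ≤ 2 ^ d := by positivity
    calc (2 : ℝ) ^ d * (d : ℝ) ^ d ≤ 2 ^ d * (Real.exp 1 ^ d * d.factorial) := mul_le_mul_of_nonneg_left h h2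
      _ = 2 ^ d * Real.exp 1 ^ d * d.factorial := by ring
  calc ρ ^ d * ((2 : ℝ) ^ d / d.factorial) ≤ ρ ^ d * (2 * Real.exp 1 / d) ^ d :=
        mul_le_mul_of_nonneg_left hkey (pow_nonneg hρ d)
    _ = (2 * Real.exp 1 * ρ / d) ^ d := by rw [← mul_pow]; congr 1; ring

/-! ## §3 The test `g(x) = min_k Σ_i|x_i − z_{k,i}|`: Lipschitz, vanishing on the atoms, and paid `≥ ρ·(1 − N(2eρ∕d)^d)` by the uniform law -/

omit [Fintype ι] in
/-- `Σ_i |u_i − v_i|` is symmetric. [bookkeeping] -/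
theorem sum_abs_sub_comm [Fintype ι] (u v : ι → ℝ) : ∑ i, |u i - v i| = ∑ i, |v i - u i| :=
  Finset.sum_congr rfl fun _ _ => abs_sub_comm _ _

/-- The distance-to-the-atoms test is `1`-Lipschitz for `Σ_i|u_i − v_i|`. [folklore] -/
theorem abs_distAtoms_sub_le {N : ℕ} (hne : (Finset.univ : Finset (Fin N)).Nonempty) (z : Fin N → ι → ℝ) (u v : ι → ℝ) :
    |Finset.univ.inf' hne (fun k => ∑ i, |u i - z k i|) - Finset.univ.inf' hne (fun k => ∑ i, |v i - z k i|)| ≤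
      ∑ i, |u i - v i| := by
  have key : ∀ u v : ι → ℝ, Finset.univ.inf' hne (fun k => ∑ i, |u i - z k i|) ≤
      Finset.univ.inf' hne (fun k => ∑ i, |v i - z k i|) + ∑ i, |u i - v i| := by
    intro u v
    obtain ⟨k, -, hk⟩ := Finset.exists_mem_eq_inf' hne (fun k => ∑ i, |v i - z k i|)
    rw [hk]
    calc Finset.univ.inf' hne (fun k => ∑ i, |u i - z k i|) ≤ ∑ i, |u i - z k i| :=
          Finset.inf'_le _ (Finset.mem_univ k)
      _ ≤ ∑ i, (|v i - z k i| + |u i - v i|) := Finset.sum_le_sum fun i _ => by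
          calc |u i - z k i| = |(u i - v i) + (v i - z k i)| := by ring_nf
            _ ≤ |u i - v i| + |v i - z k i| := abs_add_le _ _
            _ = |v i - z k i| + |u i - v i| := add_comm _ _
      _ = ∑ i, |v i - z k i| + ∑ i, |u i - v i| := Finset.sum_add_distrib
  rw [abs_sub_le_iff]
  constructor
  · linarith [key u v]
  · linarith [key v u, sum_abs_sub_comm u v]

/-- The distance-to-the-atoms test is nonnegative. [bookkeeping] -/
theorem distAtoms_nonneg {N : ℕ} (hne : (Finset.univ : Finset (Fin N)).Nonempty) (z : Fin N → ι → ℝ) (u : ι → ℝ) :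
    0 ≤ Finset.univ.inf' hne (fun k => ∑ i, |u i - z k i|) :=
  Finset.le_inf' hne _ fun _ _ => Finset.sum_nonneg fun _ _ => abs_nonneg _

/-- The distance-to-the-atoms test vanishes on the atoms. [bookkeeping] -/
theorem distAtoms_atom {N : ℕ} (hne : (Finset.univ : Finset (Fin N)).Nonempty) (z : Fin N → ι → ℝ) (k : Fin N) :
    Finset.univ.inf' hne (fun l => ∑ i, |z k i - z l i|) = 0 := by
  refine le_antisymm ?_ (distAtoms_nonneg hne z (z k))
  have h := Finset.inf'_le (fun l => ∑ i, |z k i - z l i|) (Finset.mem_univ k)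
  simpa using h

/-- The distance-to-the-atoms test is continuous. [bookkeeping] -/
theorem continuous_distAtoms {N : ℕ} (hne : (Finset.univ : Finset (Fin N)).Nonempty) (z : Fin N → ι → ℝ) :
    Continuous fun u : ι → ℝ => Finset.univ.inf' hne (fun k => ∑ i, |u i - z k i|) := by
  refine Continuous.finset_inf'_apply hne fun k _ => ?_
  exact continuous_finsetSum _ fun i _ => ((continuous_apply i).sub continuous_const).abs

/-- On the cube `[−1,1]^ι`, with atoms in the half-cube, the test is at most `2d`. [bookkeeping] -/
theorem distAtoms_le_two_mul_card {N : ℕ} (hne : (Finset.univ : Finset (Fin N)).Nonempty) {z : Fin N → ι → ℝ}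
    (hz : ∀ k i, z k i ∈ Set.Icc (-(1 / 2 : ℝ)) (1 / 2)) {u : ι → ℝ} (hu : ∀ i, u i ∈ Set.Icc (-1 : ℝ) 1) :
    Finset.univ.inf' hne (fun k => ∑ i, |u i - z k i|) ≤ 2 * Fintype.card ι := by
  obtain ⟨k, hk⟩ := hne
  calc Finset.univ.inf' ⟨k, hk⟩ (fun k => ∑ i, |u i - z k i|) ≤ ∑ i, |u i - z k i| := Finset.inf'_le _ (Finset.mem_univ k)
    _ ≤ ∑ _i : ι, (2 : ℝ) := Finset.sum_le_sum fun i _ => by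
        have h1 := hu i; have h2 := hz k i
        exact abs_le.2 ⟨by linarith [h1.1, h2.2], by linarith [h1.2, h2.1]⟩
    _ = 2 * Fintype.card ι := by rw [Finset.sum_const, Finset.card_univ, nsmul_eq_mul, mul_comm]

/-- ★ THE VOLUME COUNT.  For the uniform law `Q` on the half-cube and `N` atoms, the sub-level set `{g < ρ}` of the distance-to-the-atoms
test has `Q`-mass at most `N·(2eρ∕d)^d`. [folklore] -/
theorem measure_distAtoms_lt_le [Nonempty ι] {N : ℕ} (hne : (Finset.univ : Finset (Fin N)).Nonempty) (z : Fin N → ι → ℝ)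
    {ρ : ℝ} (hρ : 0 ≤ ρ) (C : Set (ι → ℝ)) :
    (volume.restrict C) {u : ι → ℝ | Finset.univ.inf' hne (fun k => ∑ i, |u i - z k i|) < ρ} ≤
      ENNReal.ofReal (N * (2 * Real.exp 1 * ρ / Fintype.card ι) ^ Fintype.card ι) := by
  have hsub : {u : ι → ℝ | Finset.univ.inf' hne (fun k => ∑ i, |u i - z k i|) < ρ} ⊆
      ⋃ k : Fin N, {u : ι → ℝ | ∑ i, |u i - z k i| < ρ} := by
    intro u hu
    obtain ⟨k, -, hk⟩ := Finset.exists_mem_eq_inf' hne (fun k => ∑ i, |u i - z k i|)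
    rw [Set.mem_setOf_eq, hk] at hu
    exact Set.mem_iUnion.2 ⟨k, hu⟩
  calc (volume.restrict C) {u : ι → ℝ | Finset.univ.inf' hne (fun k => ∑ i, |u i - z k i|) < ρ}
      ≤ (volume.restrict C) (⋃ k : Fin N, {u : ι → ℝ | ∑ i, |u i - z k i| < ρ}) := measure_mono hsub
    _ ≤ ∑ k : Fin N, (volume.restrict C) {u : ι → ℝ | ∑ i, |u i - z k i| < ρ} := measure_iUnion_fintype_le _ _
    _ ≤ ∑ k : Fin N, volume {u : ι → ℝ | ∑ i, |u i - z k i| < ρ} :=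
        Finset.sum_le_sum fun k _ => Measure.le_iff'.1 Measure.restrict_le_self _
    _ ≤ ∑ _k : Fin N, ENNReal.ofReal ((2 * Real.exp 1 * ρ / Fintype.card ι) ^ Fintype.card ι) :=
        Finset.sum_le_sum fun k _ => volume_l1Ball_sub_le (z k) hρ
    _ = ENNReal.ofReal (N * (2 * Real.exp 1 * ρ / Fintype.card ι) ^ Fintype.card ι) := by
        rw [Finset.sum_const, Finset.card_univ, Fintype.card_fin, nsmul_eq_mul, ENNReal.ofReal_mul (Nat.cast_nonneg N),
          ENNReal.ofReal_natCast]

/-- ★ THE PAYMENT.  For a probability law `Q = vol|_C` and `N` atoms: if `N(2eρ∕d)^d ≤ ½` (`ρ ≥ 0`) then `∫ g dQ ≥ ρ∕2` for the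
distance-to-the-atoms test `g`. [folklore] -/
theorem integral_distAtoms_ge [Nonempty ι] {N : ℕ} (hne : (Finset.univ : Finset (Fin N)).Nonempty) (z : Fin N → ι → ℝ)
    {C : Set (ι → ℝ)} (hC : IsCompact C) (hprob : IsProbabilityMeasure ((volume : Measure (ι → ℝ)).restrict C))
    {ρ : ℝ} (hρ : 0 ≤ ρ) (hsmall : N * (2 * Real.exp 1 * ρ / Fintype.card ι) ^ Fintype.card ι ≤ 1 / 2) :
    ρ / 2 ≤ ∫ u, Finset.univ.inf' hne (fun k => ∑ i, |u i - z k i|) ∂((volume : Measure (ι → ℝ)).restrict C) := by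
  set Q : Measure (ι → ℝ) := (volume : Measure (ι → ℝ)).restrict C with hQ
  set g : (ι → ℝ) → ℝ := fun u => Finset.univ.inf' hne (fun k => ∑ i, |u i - z k i|) with hg
  have hgc : Continuous g := continuous_distAtoms hne z
  have hgint : Integrable g Q := (hgc.continuousOn.integrableOn_compact hC)
  have hg0 : 0 ≤ᵐ[Q] g := Filter.Eventually.of_forall fun u => distAtoms_nonneg hne z u
  have hmarkov := mul_meas_ge_le_integral_of_nonneg hg0 hgint ρ
  -- `Q{ρ ≤ g} ≥ 1∕2`
  have hlt_meas : MeasurableSet {u | g u < ρ} := (isOpen_lt hgc continuous_const).measurableSet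
  have hcompl : {u | ρ ≤ g u} = {u | g u < ρ}ᶜ := by ext u; simp [not_lt]
  have hlt : Q.real {u | g u < ρ} ≤ 1 / 2 := by
    have h := measure_distAtoms_lt_le hne z hρ C
    rw [← hQ] at h
    exact (ENNReal.toReal_le_of_le_ofReal (by norm_num) (h.trans (ENNReal.ofReal_le_ofReal hsmall)))
  have hge : 1 / 2 ≤ Q.real {u | ρ ≤ g u} := by
    rw [hcompl, probReal_compl_eq_one_sub hlt_meas]; linarith
  calc ρ / 2 = ρ * (1 / 2) := by ring
    _ ≤ ρ * Q.real {u | ρ ≤ g u} := mul_le_mul_of_nonneg_left hge hρ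
    _ ≤ ∫ u, g u ∂Q := hmarkov

/-! ## §4 ★★★ The `d²` witness and the two-sided statement -/

/-- ★★★ **THE JOINT-LAW PRICE OF `d` STRINGS IS `d²`: the lower half.**  For every finite nonempty `ι` (`d = |ι|`) and every `t : ℕ` there are
probability laws `P, Q` on `ι → ℝ`, both carried by `[−1,1]^ι` (indeed by `[−½,½]^ι`), with `|∫∏x_i^{j_i} dP − ∫∏x_i^{j_i} dQ| ≤ (1∕2)^t` for
EVERY exponent vector `j`, and a continuous test `g ≥ 0` with `|g u − g v| ≤ Σ_i|u_i − v_i|` for all `u, v`, `|g| ≤ 2d` on `[−1,1]^ι`, and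
`d²∕(128(t + d)) ≤ ∫g dQ − ∫g dP`.  (`Q` uniform on the half-cube, `P` a Tchakaloff cubature of strength `t`, `g` the ℓ¹-distance to the
atoms.) [folklore] -/
theorem exists_uniformMixedMoments_close_laws_far_sq (ι : Type*) [Fintype ι] [Nonempty ι] (t : ℕ) :
    ∃ P Q : Measure (ι → ℝ), IsProbabilityMeasure P ∧ IsProbabilityMeasure Q ∧
      P (Set.pi Set.univ (fun _ : ι => Set.Icc (-1 : ℝ) 1))ᶜ = 0 ∧ Q (Set.pi Set.univ (fun _ : ι => Set.Icc (-1 : ℝ) 1))ᶜ = 0 ∧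
      (∀ j : ι → ℕ, |∫ x, ∏ i, x i ^ j i ∂P - ∫ x, ∏ i, x i ^ j i ∂Q| ≤ (1 / 2 : ℝ) ^ t) ∧
      ∃ g : (ι → ℝ) → ℝ, Continuous g ∧ (∀ u v : ι → ℝ, |g u - g v| ≤ ∑ i, |u i - v i|) ∧ (∀ u, 0 ≤ g u) ∧
        (∀ u : ι → ℝ, (∀ i, u i ∈ Set.Icc (-1 : ℝ) 1) → |g u| ≤ 2 * Fintype.card ι) ∧
        (Fintype.card ι : ℝ) ^ 2 / (128 * (t + Fintype.card ι)) ≤ ∫ x, g x ∂Q - ∫ x, g x ∂P := by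
  classical
  set d : ℕ := Fintype.card ι with hd
  have hd1 : 1 ≤ d := Fintype.card_pos
  have hdpos : (0 : ℝ) < d := by exact_mod_cast hd1
  -- the half-cube and its uniform law
  set C : Set (ι → ℝ) := Set.pi Set.univ (fun _ : ι => Set.Icc (-(1 / 2 : ℝ)) (1 / 2)) with hC
  have hCc : IsCompact C := isCompact_univ_pi fun _ => isCompact_Icc
  have hCm : MeasurableSet C := MeasurableSet.univ_pi fun _ => measurableSet_Icc
  set Q : Measure (ι → ℝ) := (volume : Measure (ι → ℝ)).restrict C with hQ
  have hvolC : volume C = 1 := by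
    rw [hC, Set.pi_univ_Icc, Real.volume_Icc_pi]
    simp only [sub_neg_eq_add, add_halves, ENNReal.ofReal_one, Finset.prod_const_one]
  have hQprob : IsProbabilityMeasure Q := ⟨by rw [hQ, Measure.restrict_apply_univ, hvolC]⟩
  have hQC : Q Cᶜ = 0 := by rw [hQ, Measure.restrict_apply hCm.compl, Set.compl_inter_self, measure_empty]
  -- the Tchakaloff cubature of `Q`
  obtain ⟨N, w, z, P, hPprob, hN, hw, hw1, hz, hPC, hPint, hmom⟩ := exists_cubature_measure Q hQC t
  -- the half-cube lies in the cube
  have hCsub : C ⊆ Set.pi Set.univ (fun _ : ι => Set.Icc (-1 : ℝ) 1) := by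
    intro u hu
    exact Set.mem_univ_pi.2 fun i => by
      have h := Set.mem_univ_pi.1 hu i
      exact ⟨by linarith [h.1], by linarith [h.2]⟩
  have hcarry : ∀ μ : Measure (ι → ℝ), μ Cᶜ = 0 → μ (Set.pi Set.univ (fun _ : ι => Set.Icc (-1 : ℝ) 1))ᶜ = 0 :=
    fun μ hμ => measure_mono_null (Set.compl_subset_compl.2 hCsub) hμ
  -- `N ≥ 1`
  have hNpos : 0 < N := by
    rcases Nat.eq_zero_or_pos N with h0 | h0
    · exfalso; subst h0; simp at hw1
    · exact h0
  have hne : (Finset.univ : Finset (Fin N)).Nonempty := Finset.univ_nonempty_iff.2 (Fin.pos_iff_nonempty.1 hNpos)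
  -- the test and its payment
  set g : (ι → ℝ) → ℝ := fun u => Finset.univ.inf' hne (fun k => ∑ i, |u i - z k i|) with hg
  set ρ : ℝ := (d : ℝ) ^ 2 / (8 * Real.exp 1 ^ 2 * (t + d)) with hρ
  have hepos : 0 < Real.exp 1 := Real.exp_pos 1
  have htd : (0 : ℝ) < t + d := by positivity
  have hρ0 : 0 ≤ ρ := by positivity
  have hratio : 2 * Real.exp 1 * ρ / d = d / (4 * Real.exp 1 * (t + d)) := by
    rw [hρ]; field_simp; ring
  have hsmall : N * (2 * Real.exp 1 * ρ / d) ^ d ≤ 1 / 2 := by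
    rw [hratio]
    have hx1 : (d : ℝ) / (4 * Real.exp 1 * (t + d)) ≤ 1 / 4 := by
      rw [div_le_div_iff₀ (by positivity) (by norm_num)]
      have : (1 : ℝ) ≤ Real.exp 1 := Real.one_le_exp (by norm_num)
      nlinarith
    have hx0 : (0 : ℝ) ≤ d / (4 * Real.exp 1 * (t + d)) := by positivity
    -- `N · x^d ≤ ((e(t+d)/d)^d + 1) x^d = (1/4)^d + x^d ≤ 2 (1/4)^d ≤ 1/2`
    have hprod : (Real.exp 1 * (t + d) / d) * (d / (4 * Real.exp 1 * (t + d))) = 1 / 4 := by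
      field_simp
    have h14 : ((1 : ℝ) / 4) ^ d ≤ 1 / 4 := pow_le_of_le_one (by norm_num) (by norm_num) (by omega)
    calc (N : ℝ) * (d / (4 * Real.exp 1 * (t + d))) ^ d
        ≤ ((Real.exp 1 * (t + d) / d) ^ d + 1) * (d / (4 * Real.exp 1 * (t + d))) ^ d :=
          mul_le_mul_of_nonneg_right hN (pow_nonneg hx0 d)
      _ = ((Real.exp 1 * (t + d) / d) * (d / (4 * Real.exp 1 * (t + d)))) ^ d + (d / (4 * Real.exp 1 * (t + d))) ^ d := by
          rw [mul_pow]; ring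
      _ ≤ (1 / 4 : ℝ) ^ d + (1 / 4 : ℝ) ^ d := by
          rw [hprod]; exact add_le_add le_rfl (pow_le_pow_left₀ hx0 hx1 d)
      _ ≤ 1 / 2 := by linarith
  have hpay : ρ / 2 ≤ ∫ u, g u ∂Q := integral_distAtoms_ge hne z hCc hQprob hρ0 hsmall
  have hP0 : ∫ u, g u ∂P = 0 := by
    rw [hPint g]
    refine Finset.sum_eq_zero fun k _ => ?_
    rw [hg]; simp only [distAtoms_atom hne z k, mul_zero]
  refine ⟨P, Q, hPprob, hQprob, hcarry P hPC, hcarry Q hQC, abs_moment_sub_moment_le_half_pow hPC hQC hmom, g,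
    continuous_distAtoms hne z, abs_distAtoms_sub_le hne z, distAtoms_nonneg hne z, fun u hu => ?_, ?_⟩
  · rw [abs_of_nonneg (distAtoms_nonneg hne z u)]
    exact distAtoms_le_two_mul_card hne hz hu
  · rw [hP0, sub_zero]
    calc (d : ℝ) ^ 2 / (128 * (t + d)) ≤ ρ / 2 := by
          rw [hρ, div_div, div_le_div_iff₀ (by positivity) (by positivity)]
          have h8 : Real.exp 1 ^ 2 ≤ 8 := by
            have he := Real.exp_one_lt_d9
            nlinarith [hepos.le]
          have hd2 : (0 : ℝ) ≤ (d : ℝ) ^ 2 := sq_nonneg _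
          nlinarith [mul_nonneg hd2 htd.le]
      _ ≤ ∫ u, g u ∂Q := hpay

/-- ★★ **THE DIMENSION DEPENDENCE OF THE JOINT-LAW PRICE, TWO-SIDED FOR THE GENERAL CLASS** (`d = |ι|`, `L = log r⁻¹`).
(1) [module 65, verbatim] every pair of laws on `[−1,1]^ι` with all mixed moments `r`-close pays an ℓ¹-`K`-Lipschitz `G`-bounded functional at
most `(76K d² + 12G d)∕(1 + L)`; (2) [this module] for every `0 < r₀ ≤ 1` there are laws on `[−1,1]^ι` with all mixed moments `r`-close for some
`0 < r ≤ r₀` and a continuous `1`-ℓ¹-Lipschitz test, `0 ≤ g ≤ 2d` on the cube, paid at least `d²∕(256(d + L))`.  At `K = 1`, `G = 2d` the two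
read `100d²∕(1+L)` vs `d²∕(256(d+L))`: `Θ(d²∕L)` once `L ≥ d` — the general class is a factor `|ι|` above the additive class of module 66.
[folklore] -/
theorem jointLaw_price_general_two_sided (ι : Type*) [Fintype ι] [Nonempty ι] :
    (∀ (P Q : Measure (ι → ℝ)) [IsProbabilityMeasure P] [IsProbabilityMeasure Q],
      P (Set.pi Set.univ (fun _ : ι => Set.Icc (-1 : ℝ) 1))ᶜ = 0 → Q (Set.pi Set.univ (fun _ : ι => Set.Icc (-1 : ℝ) 1))ᶜ = 0 →
      ∀ r : ℝ, 0 < r → r ≤ 1 → (∀ j : ι → ℕ, |∫ x, ∏ i, x i ^ j i ∂P - ∫ x, ∏ i, x i ^ j i ∂Q| ≤ r) →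
      ∀ f : (ι → ℝ) → ℝ, Continuous f → ∀ K G : ℝ, 0 ≤ K →
        (∀ u v : ι → ℝ, (∀ i, u i ∈ Set.Icc (-1 : ℝ) 1) → (∀ i, v i ∈ Set.Icc (-1 : ℝ) 1) → |f u - f v| ≤ K * ∑ i, |u i - v i|) →
        (∀ u : ι → ℝ, (∀ i, u i ∈ Set.Icc (-1 : ℝ) 1) → |f u| ≤ G) →
        |∫ x, f x ∂P - ∫ x, f x ∂Q| ≤ (76 * K * (Fintype.card ι : ℝ) ^ 2 + 12 * G * Fintype.card ι) / (1 + Real.log r⁻¹)) ∧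
    (∀ r₀ : ℝ, 0 < r₀ → r₀ ≤ 1 → ∃ P Q : Measure (ι → ℝ), IsProbabilityMeasure P ∧ IsProbabilityMeasure Q ∧
      P (Set.pi Set.univ (fun _ : ι => Set.Icc (-1 : ℝ) 1))ᶜ = 0 ∧ Q (Set.pi Set.univ (fun _ : ι => Set.Icc (-1 : ℝ) 1))ᶜ = 0 ∧
      ∃ r : ℝ, 0 < r ∧ r ≤ r₀ ∧ (∀ j : ι → ℕ, |∫ x, ∏ i, x i ^ j i ∂P - ∫ x, ∏ i, x i ^ j i ∂Q| ≤ r) ∧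
        ∃ g : (ι → ℝ) → ℝ, Continuous g ∧ (∀ u v : ι → ℝ, |g u - g v| ≤ ∑ i, |u i - v i|) ∧ (∀ u, 0 ≤ g u) ∧
          (∀ u : ι → ℝ, (∀ i, u i ∈ Set.Icc (-1 : ℝ) 1) → |g u| ≤ 2 * Fintype.card ι) ∧
          (Fintype.card ι : ℝ) ^ 2 / (256 * (Fintype.card ι + Real.log r⁻¹)) ≤ |∫ x, g x ∂P - ∫ x, g x ∂Q|) := by
  classical
  refine ⟨fun P Q _ _ hP hQ r hr0 hr1 hmom f hf K G hK0 hK hG =>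
    law_price_le_of_uniformMixedMoments hP hQ hr0 hr1 hmom hf hK0 hK hG, fun r₀ hr₀ _ => ?_⟩
  obtain ⟨t, ht⟩ := exists_pow_lt_of_lt_one hr₀ (by norm_num : (1 / 2 : ℝ) < 1)
  obtain ⟨P, Q, hPp, hQp, hP, hQ, hmom, g, hgc, hgL, hg0, hgB, hpay⟩ := exists_uniformMixedMoments_close_laws_far_sq ι t
  set d : ℕ := Fintype.card ι with hd
  have hdpos : (0 : ℝ) < d := by exact_mod_cast (Fintype.card_pos : 0 < d)
  refine ⟨P, Q, hPp, hQp, hP, hQ, (1 / 2 : ℝ) ^ t, by positivity, ht.le, hmom, g, hgc, hgL, hg0, hgB, ?_⟩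
  have hL : Real.log ((1 / 2 : ℝ) ^ t)⁻¹ = t * Real.log 2 := by
    rw [← inv_pow, one_div, inv_inv, Real.log_pow]
  have hlog2 : (1 / 2 : ℝ) < Real.log 2 := by have := Real.log_two_gt_d9; linarith
  rw [hL, abs_sub_comm, abs_of_nonneg (by
    have h : (0 : ℝ) ≤ (d : ℝ) ^ 2 / (128 * (t + d)) := by positivity
    linarith)]
  calc (d : ℝ) ^ 2 / (256 * (d + t * Real.log 2)) ≤ (d : ℝ) ^ 2 / (128 * (t + d)) := by
        refine div_le_div_of_nonneg_left (sq_nonneg _) (by positivity) ?_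
        nlinarith [hdpos, (Nat.cast_nonneg t : (0 : ℝ) ≤ t)]
    _ ≤ ∫ x, g x ∂Q - ∫ x, g x ∂P := hpay

end Summit.QuantumFields.YangMills.Theorems.BalabanUVNodesN19JointLawPriceDimensionSharp

end
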